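import Literature.Computability.AlgebraicComplexity.GlobalStageEpsilon
import Literature.Computability.AlgebraicComplexity.GlobalStageRegions
import Literature.Computability.AlgebraicComplexity.InterfaceSlotSymmetry
import HarnessLib

/-!
# VXXZ Theorem 5.3, three regions: the global stage
(Vassilevska Williams–Xu–Xu–Zhou 2024, Prop. 5.1 / Thm. 5.3 with §5.1 "Dividing into Regions" and
§5.7 "Overall") — proved, explicit errors

Topic `Literature/Computability/AlgebraicComplexity`.  §5.1: `(CW_q^{⊗2^{ℓ−1}})^{⊗n} ≡ ⊗_{r∈[3]}
(CW_q^{⊗2^{ℓ−1}})^{⊗A_r n}`; "We will use asymmetric hashing that shares level-`ℓ` `Z`-blocks in the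
first region, `Y`-blocks in the second region, and `X`-blocks in the third region … the output will
be the tensor product of the independent copies of the three level-`ℓ` interface tensors from the
three regions … the analysis for the other two regions follow by symmetry."  With the one-region
theorem `vxxz2024_thm53_region` (`GlobalStageEpsilon.lean`) this file PROVES the three-region
statement at fixed `n₁ = A₁n, n₂ = A₂n, n₃ = A₃n`:

* `RegionDatum` — the data of one region in the `Z`-shared orientation (joint type `Q` with
  `∑ Q = n_r` supported on level triples, a triple `T₀` of type `Q`, target split distributions with
  `0 ≤ γ_Z ≤ 1`), its term map / parameter list / exponent
  `E = min{H(Q_X/n) − P, H(Q_Y/n) − P, H(γ̄_Z) − λ_Z, H(Q/n)}`, and `vxxz2024_thm53_regionDatum`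
  (the one-region theorem restated for a datum);
* `tensorRestrictsTo_inputCopies_swapYZ/swapXZ` — the symmetry of §5.7 with input multiplicities:
  a degeneration `⟨N⟩ ⊗ (CW_q^{⊗c})^{⊗n} ≥ ⟨κ⟩ ⊗ 𝒯_{τ,L,ε}` yields the same for the `Y ↔ Z`
  (resp. `X ↔ Z`) renamed parameter list (so a datum written in the `Z`-shared orientation serves the
  `Y`-shared second and the `X`-shared third region: its exponent is the printed
  `E₂ = min{H(α_X) − P, H(α_Z) − P, H(γ̄_Y) − λ_Y}`, resp. `E₃`, of the renamed data);
* `tensorRestrictsTo_inputCopies_mul` — products of regions with input multiplicities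
  (`⟨N₁N₂⟩ ⊗ (CW_q^{⊗c})^{⊗(n₁+n₂)} ≥ ⟨κ₁κ₂⟩ ⊗ 𝒯_{τ₁⧺τ₂, L₁⧺L₂, ε}`);
* `vxxz2024_thm53` — **Thm. 5.3**: for three data `D₁, D₂, D₃`,
  `⟨N₁N₂N₃⟩ ⊗ (CW_q^{⊗c})^{⊗(n₁+n₂+n₃)} ≥ ⟨κ₁κ₂κ₃⟩ ⊗ 𝒯_{τ₁⧺τ₂⧺τ₃, L₁ ⧺ L₂^{YZ} ⧺ L₃^{XZ}, ε}` with
  `N_r = ((n_r+1)^{3^c|S₃|})^3 = 2^{o(n)}` and `log₂(κ_r+1) ≥ n_r (E_r − epsLoss(ε)) − thm53Err(n_r)`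
  — the printed `2^{(A₁E₁ + A₂E₂ + A₃E₃ − o_{1/ε}(1))n − o(n)}` copies of the level-`ℓ`
  `ε`-interface tensor with parameter list `{(n A_r α^{(r)}(i,j,k), i, j, k, γ^{(r)}_X, γ^{(r)}_Y, γ^{(r)}_Z)}_{r, i+j+k=2^ℓ}`.

Everything is proved; the definitions are `RegionDatum` and its projections; no named facts.

## References

* V. Vassilevska Williams, Y. Xu, Z. Xu, R. Zhou, *New bounds for matrix multiplication: from alpha
  to omega*, SODA 2024, arXiv:2307.07970 (held: `paper:arxiv-2307.07970`), Prop. 5.1, Thm. 5.3,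
  §5.1 and §5.7. [VassilevskaWilliamsXuXuZhou2024]
-/

noncomputable section

open scoped BigOperators
open Finset

namespace Literature.Computability.AlgebraicComplexity

open Literature.Barriers.MatrixMultiplication (bigCwTensor tensorRestrictsTo_unitTensor_mul
  tensorRestrictsTo_kroneckerPow_add tensorRestrictsTo_kronecker_interchange unitTensor_eq_kronecker_comp)

universe u

/-! ## Symmetries and products with input multiplicities -/

section InputCopies

variable (K : Type u) [CommSemiring K] (q : ℕ) {c n s n₁ n₂ s₁ s₂ : ℕ}

/-- `⟨Fq⟩ ≥ ⟨F⟩ ⊗ ⟨q⟩` (relabelling by `finProdFinEquiv`; with `tensorRestrictsTo_unitTensor_mul` an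
isomorphism). [folklore] -/
theorem tensorRestrictsTo_mul_unitTensor (F r : ℕ) :
    TensorRestrictsTo (unitTensor K (F * r)) (kroneckerTensor (unitTensor K F) (unitTensor K r)) := by
  have key : kroneckerTensor (unitTensor K F) (unitTensor K r) = fun a b d =>
      unitTensor K (F * r) (finProdFinEquiv a) (finProdFinEquiv b) (finProdFinEquiv d) := by
    rw [unitTensor_eq_kronecker_comp (K := K) (finProdFinEquiv (m := F) (n := r)).symm]
    funext a b d
    simp
  rw [key]
  exact TensorRestrictsTo.comap _ _ _ _

/-- `⟨N⟩ ⊗ (CW_q^{⊗c})^{⊗n}` is symmetric under swapping the first and third slots. [folklore] -/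
theorem inputCopies_swap₁₃ (N : ℕ) (u v w : Fin N × (Fin n → Fin c → Fin (q + 2))) :
    kroneckerTensor (unitTensor K N) (kroneckerPow (kroneckerPow (bigCwTensor K q) c) n) w v u =
      kroneckerTensor (unitTensor K N) (kroneckerPow (kroneckerPow (bigCwTensor K q) c) n) u v w := by
  simp only [kroneckerTensor_apply]
  rw [(unitTensor_perm K N u.1 v.1 w.1).1, kroneckerPow_bigCw_swap₁₃]

/-- `⟨N⟩ ⊗ (CW_q^{⊗c})^{⊗n}` is symmetric under swapping the last two slots. [folklore] -/
theorem inputCopies_swap₂₃ (N : ℕ) (u v w : Fin N × (Fin n → Fin c → Fin (q + 2))) :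
    kroneckerTensor (unitTensor K N) (kroneckerPow (kroneckerPow (bigCwTensor K q) c) n) u w v =
      kroneckerTensor (unitTensor K N) (kroneckerPow (kroneckerPow (bigCwTensor K q) c) n) u v w := by
  simp only [kroneckerTensor_apply]
  rw [(unitTensor_perm K N u.1 v.1 w.1).2.2, kroneckerPow_bigCw_swap₂₃]

/-- **The `X ↔ Z` symmetry with input multiplicities** (§5.7, "by symmetry"): from
`⟨N⟩ ⊗ (CW_q^{⊗c})^{⊗n} ≥ ⟨κ⟩ ⊗ 𝒯_{τ,L,ε}` one gets `⟨N⟩ ⊗ (CW_q^{⊗c})^{⊗n} ≥ ⟨κ⟩ ⊗ 𝒯_{τ,L^{XZ},ε}`.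
[cite: VassilevskaWilliamsXuXuZhou2024, §5.7 ("By symmetry, we can apply the same method to the second and third region")] -/
theorem tensorRestrictsTo_inputCopies_swapXZ (N : ℕ) (τ : Fin n → Fin s) (L : Fin s → InterfaceTerm c) (ε : ℝ) (κ : ℕ)
    (h : TensorRestrictsTo (kroneckerTensor (unitTensor K N) (kroneckerPow (kroneckerPow (bigCwTensor K q) c) n))
      (kroneckerTensor (unitTensor K κ) (interfaceTensor K q τ L ε))) :
    TensorRestrictsTo (kroneckerTensor (unitTensor K N) (kroneckerPow (kroneckerPow (bigCwTensor K q) c) n))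
      (kroneckerTensor (unitTensor K κ) (interfaceTensor K q τ (fun t => (L t).swapXZ) ε)) := by
  have h' := h.swap₁₃.swap₂₃
  have e1 : (fun u v w => kroneckerTensor (unitTensor K N) (kroneckerPow (kroneckerPow (bigCwTensor K q) c) n) w v u) =
      kroneckerTensor (unitTensor K N) (kroneckerPow (kroneckerPow (bigCwTensor K q) c) n) := by
    funext u v w; exact inputCopies_swap₁₃ K q N u v w
  have e2 : (fun u v w => kroneckerTensor (unitTensor K κ) (interfaceTensor K q τ L ε) w v u) =
      kroneckerTensor (unitTensor K κ) (interfaceTensor K q τ (fun t => (L t).swapXZ) ε) := by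
    funext u v w
    simp only [kroneckerTensor_apply]
    rw [(unitTensor_perm K κ u.1 v.1 w.1).1, interfaceTensor_swapXZ]
  rw [e1, e2] at h'
  exact h'

/-- **The `Y ↔ Z` symmetry with input multiplicities.** [cite: VassilevskaWilliamsXuXuZhou2024, §5.7] -/
theorem tensorRestrictsTo_inputCopies_swapYZ (N : ℕ) (τ : Fin n → Fin s) (L : Fin s → InterfaceTerm c) (ε : ℝ) (κ : ℕ)
    (h : TensorRestrictsTo (kroneckerTensor (unitTensor K N) (kroneckerPow (kroneckerPow (bigCwTensor K q) c) n))
      (kroneckerTensor (unitTensor K κ) (interfaceTensor K q τ L ε))) :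
    TensorRestrictsTo (kroneckerTensor (unitTensor K N) (kroneckerPow (kroneckerPow (bigCwTensor K q) c) n))
      (kroneckerTensor (unitTensor K κ) (interfaceTensor K q τ (fun t => (L t).swapYZ) ε)) := by
  have h' := h.swap₂₃
  have e1 : (fun u v w => kroneckerTensor (unitTensor K N) (kroneckerPow (kroneckerPow (bigCwTensor K q) c) n) u w v) =
      kroneckerTensor (unitTensor K N) (kroneckerPow (kroneckerPow (bigCwTensor K q) c) n) := by
    funext u v w; exact inputCopies_swap₂₃ K q N u v w
  have e2 : (fun u v w => kroneckerTensor (unitTensor K κ) (interfaceTensor K q τ L ε) u w v) =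
      kroneckerTensor (unitTensor K κ) (interfaceTensor K q τ (fun t => (L t).swapYZ) ε) := by
    funext u v w
    simp only [kroneckerTensor_apply]
    rw [(unitTensor_perm K κ u.1 v.1 w.1).2.2, interfaceTensor_swapYZ]
  rw [e1, e2] at h'
  exact h'

/-- **Products of regions with input multiplicities** (§5.7 "Overall"):
`⟨N₁N₂⟩ ⊗ (CW_q^{⊗c})^{⊗(n₁+n₂)} ≥ ⟨κ₁κ₂⟩ ⊗ 𝒯_{τ₁⧺τ₂, L₁⧺L₂, ε}`. [cite: VassilevskaWilliamsXuXuZhou2024, §5.7 (Summary)] -/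
theorem tensorRestrictsTo_inputCopies_mul {N₁ N₂ κ₁ κ₂ : ℕ} (τ₁ : Fin n₁ → Fin s₁) (L₁ : Fin s₁ → InterfaceTerm c)
    (τ₂ : Fin n₂ → Fin s₂) (L₂ : Fin s₂ → InterfaceTerm c) (ε : ℝ)
    (h₁ : TensorRestrictsTo (kroneckerTensor (unitTensor K N₁) (kroneckerPow (kroneckerPow (bigCwTensor K q) c) n₁))
      (kroneckerTensor (unitTensor K κ₁) (interfaceTensor K q τ₁ L₁ ε)))
    (h₂ : TensorRestrictsTo (kroneckerTensor (unitTensor K N₂) (kroneckerPow (kroneckerPow (bigCwTensor K q) c) n₂))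
      (kroneckerTensor (unitTensor K κ₂) (interfaceTensor K q τ₂ L₂ ε))) :
    TensorRestrictsTo (kroneckerTensor (unitTensor K (N₁ * N₂)) (kroneckerPow (kroneckerPow (bigCwTensor K q) c) (n₁ + n₂)))
      (kroneckerTensor (unitTensor K (κ₁ * κ₂)) (interfaceTensor K q (concatTermMap τ₁ τ₂) (Fin.append L₁ L₂) ε)) := by
  refine (TensorRestrictsTo.kronecker (tensorRestrictsTo_mul_unitTensor K N₁ N₂)
    (tensorRestrictsTo_kroneckerPow_add _ n₁ n₂)).trans ?_
  refine (tensorRestrictsTo_kronecker_interchange _ _ _ _).trans ?_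
  refine (TensorRestrictsTo.kronecker h₁ h₂).trans ?_
  refine (tensorRestrictsTo_kronecker_interchange _ _ _ _).trans ?_
  exact TensorRestrictsTo.kronecker (tensorRestrictsTo_unitTensor_mul (K := K) κ₁ κ₂)
    (tensorRestrictsTo_kronecker_interfaceTensor_concat K q τ₁ τ₂ L₁ L₂ ε)

end InputCopies

/-! ## The datum of one region -/

/-- **The datum of one region of the global stage, in the `Z`-shared orientation**: a joint type `Q`
of level-`ℓ` block triples (`∑ Q = n`, supported on `i+j+k = 2c`; `α^{(r)} = Q/n`), a triple `T₀` of
type `Q` (its term map realises the parameter list), and the target complete split distributions with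
`0 ≤ γ_Z ≤ 1`.  For the second (third) region one supplies the `Y ↔ Z` (`X ↔ Z`) renamed data.
[cite: VassilevskaWilliamsXuXuZhou2024, Prop. 5.1 (the data α^{(r)}, β^{(r)}_{W,i,j,k})] -/
structure RegionDatum (c n : ℕ) where
  /-- the joint type `n · α` -/
  Q : Fin (2 * c + 1) × Fin (2 * c + 1) × Fin (2 * c + 1) → ℕ
  /-- a block triple of type `Q` -/
  T₀ : (Fin n → Fin (2 * c + 1)) × (Fin n → Fin (2 * c + 1)) × (Fin n → Fin (2 * c + 1))
  /-- target split distributions of the `X`-blocks -/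
  γX : ℕ × ℕ × ℕ → (Fin c → Fin 3) → ℝ
  /-- target split distributions of the `Y`-blocks -/
  γY : ℕ × ℕ × ℕ → (Fin c → Fin 3) → ℝ
  /-- target split distributions of the (shared) `Z`-blocks -/
  γZ : ℕ × ℕ × ℕ → (Fin c → Fin 3) → ℝ
  /-- `∑ Q = n` -/
  sum_Q : ∑ s, Q s = n
  /-- `Q` is supported on level triples -/
  Q_supp : ∀ s, s ∉ levelSupport (2 * c) → Q s = 0
  /-- `T₀` has type `Q` -/
  T₀_mem : T₀ ∈ jointTypeClass n Q
  /-- `γ_Z ≥ 0` -/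
  γZ_nonneg : ∀ ijk σ, 0 ≤ γZ ijk σ
  /-- `γ_Z ≤ 1` -/
  γZ_le_one : ∀ ijk σ, γZ ijk σ ≤ 1

namespace RegionDatum

variable {c n : ℕ} (D : RegionDatum c n)

/-- The term map of the datum (chunk `t ↦ (I_t, J_t, K_t)` of `T₀`). [cite: VassilevskaWilliamsXuXuZhou2024, §5.5] -/
def termMap : Fin n → Fin (constituentTriples c).card :=
  tripleTermMap (isLevelTriple_of_mem_jointTypeClass D.Q_supp D.T₀_mem)

/-- The parameter list `{(i,j,k, γ_X, γ_Y, γ_Z)}_{i+j+k=2c}` of the datum. [cite: VassilevskaWilliamsXuXuZhou2024, Prop. 5.1] -/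
def termList : Fin (constituentTriples c).card → InterfaceTerm c := tripleTermList c D.γX D.γY D.γZ

/-- **The exponent `E` of the datum** at the type: `min{H(Q_X/n) − P, H(Q_Y/n) − P, H(γ̄_Z) − λ_Z, H(Q/n)}`,
`P = maxEnt(Q/n) − H(Q/n)`. [cite: VassilevskaWilliamsXuXuZhou2024, Prop. 5.1 (E₁, E₂, E₃)] -/
def exponent : ℝ :=
  min (min (shannonEntropy (fun i => ((∑ j, ∑ l, D.Q (i, j, l) : ℕ) : ℝ) / n) -
          (maxEntropyGivenMarginals (levelSupport (2 * c)) (fun s => (D.Q s : ℝ) / n) - shannonEntropy (fun s => (D.Q s : ℝ) / n)))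
        (shannonEntropy (fun j => ((∑ i, ∑ l, D.Q (i, j, l) : ℕ) : ℝ) / n) -
          (maxEntropyGivenMarginals (levelSupport (2 * c)) (fun s => (D.Q s : ℝ) / n) - shannonEntropy (fun s => (D.Q s : ℝ) / n))))
    (min (shannonEntropy (targetPairDist (isLevelTriple_of_mem_jointTypeClass D.Q_supp D.T₀_mem) D.γZ) -
          targetLambda (isLevelTriple_of_mem_jointTypeClass D.Q_supp D.T₀_mem) (typeAlpha n D.Q) D.γZ)
      (shannonEntropy (fun s => (D.Q s : ℝ) / n)))

end RegionDatum

/-- The number `((n+1)^{3^c |S₃|})^3 = 2^{o(n)}` of input copies of one region. [cite: VassilevskaWilliamsXuXuZhou2024, Thm. 5.3 ("2^{o(n)} independent copies")] -/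
def inputCopies (c n : ℕ) : ℕ := ((n + 1) ^ (3 ^ c * (constituentTriples c).card)) ^ 3

/-! ## Theorem 5.3 -/

section Thm53

variable (K : Type u) [CommSemiring K] (q : ℕ) {c : ℕ}

/-- **Thm. 5.3, one region, for a datum** (`vxxz2024_thm53_region` restated). [cite: VassilevskaWilliamsXuXuZhou2024, Thm. 5.3] -/
theorem vxxz2024_thm53_regionDatum (hc : 0 < c) {n : ℕ} (hn : 0 < n) (D : RegionDatum c n) {ε : ℝ}
    (hε0 : 0 ≤ ε) (hε1 : ε ≤ 1) :
    ∃ κ : ℕ,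
      TensorRestrictsTo (kroneckerTensor (unitTensor K (inputCopies c n)) (kroneckerPow (kroneckerPow (bigCwTensor K q) c) n))
        (kroneckerTensor (unitTensor K κ) (interfaceTensor K q D.termMap D.termList ε)) ∧
      (n : ℝ) * (D.exponent - epsLoss c ε) - thm53Err c n ≤ Real.logb 2 ((κ : ℝ) + 1) :=
  vxxz2024_thm53_region K q hc hn D.sum_Q D.Q_supp D.T₀_mem D.γX D.γY D.γZ D.γZ_nonneg D.γZ_le_one hε0 hε1

/-- **Vassilevska Williams–Xu–Xu–Zhou, Theorem 5.3 (the global stage), at fixed region sizes and with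
explicit errors.**  For three region data `D₁, D₂, D₃` (sizes `n₁, n₂, n₃ ≥ 1`, i.e. `A_r n`; the second
and third written in the `Z`-shared orientation) and `0 ≤ ε ≤ 1`:
`⟨N₁N₂N₃⟩ ⊗ (CW_q^{⊗c})^{⊗(n₁+n₂+n₃)} ≥ ⟨κ₁κ₂κ₃⟩ ⊗ 𝒯_{τ₁⧺τ₂⧺τ₃, L₁ ⧺ L₂^{YZ} ⧺ L₃^{XZ}, ε}`,
`N_r = ((n_r+1)^{3^c|S₃|})^3`, `log₂(κ_r+1) ≥ n_r (E_r − epsLoss c ε) − thm53Err c n_r` — i.e.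
`2^{o(n)}` independent copies of the input degenerate into
`2^{(A₁E₁ + A₂E₂ + A₃E₃ − o_{1/ε}(1)) n − o(n)}` independent copies of the level-`ℓ` `ε`-interface
tensor whose parameter list is the concatenation over the three regions (the second region sharing
`Y`-blocks, the third `X`-blocks). [cite: VassilevskaWilliamsXuXuZhou2024, Thm. 5.3 and Prop. 5.1] -/
theorem vxxz2024_thm53 (hc : 0 < c) {n₁ n₂ n₃ : ℕ} (hn₁ : 0 < n₁) (hn₂ : 0 < n₂) (hn₃ : 0 < n₃)
    (D₁ : RegionDatum c n₁) (D₂ : RegionDatum c n₂) (D₃ : RegionDatum c n₃) {ε : ℝ} (hε0 : 0 ≤ ε) (hε1 : ε ≤ 1) :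
    ∃ κ₁ κ₂ κ₃ : ℕ,
      TensorRestrictsTo
        (kroneckerTensor (unitTensor K (inputCopies c n₁ * inputCopies c n₂ * inputCopies c n₃))
          (kroneckerPow (kroneckerPow (bigCwTensor K q) c) (n₁ + n₂ + n₃)))
        (kroneckerTensor (unitTensor K (κ₁ * κ₂ * κ₃))
          (interfaceTensor K q (concatTermMap (concatTermMap D₁.termMap D₂.termMap) D₃.termMap)
            (Fin.append (Fin.append D₁.termList (fun t => (D₂.termList t).swapYZ)) (fun t => (D₃.termList t).swapXZ)) ε)) ∧
      (n₁ : ℝ) * (D₁.exponent - epsLoss c ε) - thm53Err c n₁ ≤ Real.logb 2 ((κ₁ : ℝ) + 1) ∧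
      (n₂ : ℝ) * (D₂.exponent - epsLoss c ε) - thm53Err c n₂ ≤ Real.logb 2 ((κ₂ : ℝ) + 1) ∧
      (n₃ : ℝ) * (D₃.exponent - epsLoss c ε) - thm53Err c n₃ ≤ Real.logb 2 ((κ₃ : ℝ) + 1) := by
  obtain ⟨κ₁, h₁, b₁⟩ := vxxz2024_thm53_regionDatum K q hc hn₁ D₁ hε0 hε1
  obtain ⟨κ₂, h₂, b₂⟩ := vxxz2024_thm53_regionDatum K q hc hn₂ D₂ hε0 hε1
  obtain ⟨κ₃, h₃, b₃⟩ := vxxz2024_thm53_regionDatum K q hc hn₃ D₃ hε0 hε1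
  refine ⟨κ₁, κ₂, κ₃, ?_, b₁, b₂, b₃⟩
  have h₂' := tensorRestrictsTo_inputCopies_swapYZ K q _ D₂.termMap D₂.termList ε κ₂ h₂
  have h₃' := tensorRestrictsTo_inputCopies_swapXZ K q _ D₃.termMap D₃.termList ε κ₃ h₃
  have h₁₂ := tensorRestrictsTo_inputCopies_mul K q D₁.termMap D₁.termList D₂.termMap (fun t => (D₂.termList t).swapYZ) ε h₁ h₂'
  exact tensorRestrictsTo_inputCopies_mul K q _ _ D₃.termMap (fun t => (D₃.termList t).swapXZ) ε h₁₂ h₃'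

end Thm53

end Literature.Computability.AlgebraicComplexity
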